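import Mathlib
import HarnessLib
import Literature.MathematicalPhysics.KineticTheory.VelocityFlipNoise
import Summits.AtomisticToContinuum.FouriersLaw.Theorems.VanishingNoiseTransferVanishingNoiseBoundFlipDualKuboLink
import Summits.AtomisticToContinuum.FouriersLaw.Theorems.VanishingNoiseTransferVanishingNoiseBoundFlipMildForwardFieldTemps
import Summits.AtomisticToContinuum.FouriersLaw.Theorems.VanishingNoiseTransferVanishingNoiseBoundFlipWeakToClassical
import Summits.AtomisticToContinuum.FouriersLaw.Theorems.VanishingNoiseTransferVanishingNoiseBoundFlipWeakContinuity
import Summits.AtomisticToContinuum.FouriersLaw.Theorems.VanishingNoiseTransferVanishingNoiseBoundFlipUniformMoments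
import Summits.AtomisticToContinuum.FouriersLaw.Theorems.VanishingNoiseTransferVanishingNoiseBoundFlipMildDistributional
import Summits.AtomisticToContinuum.FouriersLaw.Theorems.VanishingNoiseTransferVanishingNoiseBoundFlipHypoelliptic
import Summits.AtomisticToContinuum.FouriersLaw.Theorems.VanishingNoiseTransferVanishingNoiseBoundFlipSmoothMildUpgrade
import Summits.AtomisticToContinuum.FouriersLaw.Theorems.VanishingNoiseTransferVanishingNoiseBoundFlipMildContinuity

/-!
# Every finite flip-noisy pinned anharmonic chain conducts: `0 < D_N(ε)` (stub S3 of line `fekete-usc-one-length`, PROVED)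

`--supports stmt-AtomisticToContinuum-11976` file (crux `VanishingNoiseBound`, route `VanishingNoiseTransfer`, line
`fekete-usc-one-length`). The S3 side of the line, assembled: for the pinned anharmonic chain `pinnedChain ω₂ lam β γ` (all
parameters `> 0`) with Bernardin–Olla velocity flips at every site at ANY rate `ε > 0`, Langevin baths at the two ends, a
temperature `T > 0`, THE unique weak flip-steady family `μ` and its linear-response coefficients
`D_N(ε) = lim_{δ→0, δ≠0} totalCurrent(μ_{N,T+δ/2,T−δ/2})/δ`: `0 < D_N(ε)` for every `N ≥ 2`.

* `flip_tendsto_centring` — `∫ (p_0² − T) dμ_{T+δ/2,T−δ/2} → ∫ (p_0² − T) dμ_{T,T}` (landed weak continuity + uniform moments).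
* `flip_dualForwardFields` — the hypothesis `FF''(ε)` of the landed derivative-free ("dual") Kubo road
  `noisyPositiveConductance_of_dualForwardFields` (…FlipDualKuboLink), DISCHARGED from the four landed wave-5 theorems of the
  line: `stub_flipMildDistributional` (mild forward fields are distributional solutions, …FlipMildDistributional),
  `stub_flipHypoelliptic` (`C^∞`-hypoellipticity of `L + εS`, …FlipHypoelliptic via `Literature.Analysis.Hypoelliptic.CoupledSystem`),
  `stub_flipSmoothMildUpgrade` (the continuous representative of a mild field is mild, …FlipSmoothMildUpgrade) and
  `stub_flipMildContinuity` (pairing continuity of the centred mild family at `δ = 0`, …FlipMildContinuity): the family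
  `g δ` = centred mild forward field at `(T ± δ/2)` for `0 < |δ| < T`, `g 0` = the smooth representative of the mild field at
  `(T, T)` (whose centring constant vanishes by uniqueness + equipartition), satisfies clauses (i)–(iv) with `δ₀ = T`.
* `flip_noisyPositiveConductance` — **S3**: `0 < D_N(ε)` for `N ≥ 2`, every `ε > 0` (the flip twin of
  `JunctionLocality.PositiveConductance`, stmt-AtomisticToContinuum-11750).

References: Bonetto–Lebowitz–Rey-Bellet 2000 eq. (32); Rey-Bellet 2003 Rem. 4.4; Bernardin–Olla 2011 §2.1, §6; Hörmander 1967
Thm 1.1; Hairer–Mattingly 2011; Cuneo–Eckmann–Hairer–Rey-Bellet 2018 §3.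
-/

noncomputable section

open MeasureTheory Filter Topology
open scoped ContDiff
open Literature.MathematicalPhysics.KineticTheory.HeatConduction
open Summit.AtomisticToContinuum.FouriersLaw.Cruxes.SuperadditiveResistance.FloatingProbeBypassLaplacian
  (pinnedChain_memLp_two_snd pinnedChain_integral_snd_sq)

namespace Summit.AtomisticToContinuum.FouriersLaw.Theorems.VanishingNoiseBound

/-- The centring constants of the mild family tend to the equilibrium one: `∫ (p_0² − T) dμ_{T+δ/2,T−δ/2} →
∫ (p_0² − T) dμ_{T,T}` as `δ → 0`, `δ ≠ 0` (landed weak continuity of the unique flip-steady family on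
exponentially dominated observables + uniform `e^{H/2T}` moments). -/
theorem flip_tendsto_centring {ω₂ lam β γ : ℝ} (hω : 0 < ω₂) (hl : 0 < lam) (hβ : 0 < β) (hγ : 0 < γ)
    {T ε : ℝ} (hT : 0 < T) (hε : 0 < ε)
    (μ : (N : ℕ) → ℝ → ℝ → Measure (PhaseSpace N))
    (hμ : ∀ (N : ℕ) (T_L T_R : ℝ), 0 < T_L → 0 < T_R →
      (pinnedChain ω₂ lam β γ).IsFlipSteadyState N T_L T_R ε (μ N T_L T_R) ∧
        ∀ ν : Measure (PhaseSpace N), (pinnedChain ω₂ lam β γ).IsFlipSteadyState N T_L T_R ε ν → ν = μ N T_L T_R)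
    {L : ℕ} (hL : 2 ≤ L) :
    Tendsto (fun δ : ℝ => ∫ w, (w.2 ⟨0, by omega⟩ ^ 2 - T) ∂(μ L (T + δ / 2) (T - δ / 2))) (𝓝[≠] 0)
      (𝓝 (∫ w, (w.2 ⟨0, by omega⟩ ^ 2 - T) ∂(μ L T T))) := by
  obtain ⟨M, hM⟩ := flip_uniform_exp_moment hω hl hβ hγ hε μ hμ hT hL
  have hϑ0 : (0 : ℝ) ≤ 1 / (4 * T) := by positivity
  have hϑ1 : 1 / (4 * T) < 1 / (2 * T) := by
    rw [div_lt_div_iff₀ (by positivity) (by positivity)]; nlinarith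
  have hcont : Continuous fun w : PhaseSpace L => w.2 ⟨0, by omega⟩ ^ 2 - T := by fun_prop
  have hbd : ∀ w : PhaseSpace L, |w.2 ⟨0, by omega⟩ ^ 2 - T| ≤
      (2 / (1 / (4 * T)) + T) * Real.exp (1 / (4 * T) * (pinnedChain ω₂ lam β γ).hamiltonian L w) :=
    fun w => Theorems.SubdiffusiveBondHeat.abs_sq_momentum_sub_le_exp hω hl.le hβ.le (by positivity) hT.le w _
  exact (flip_tendsto_integral_of_growth hω hl hβ ε μ hμ hT hM hcont hϑ0 hϑ1 hbd).2

/-- **`FF''(ε)` — the hypothesis of the dual Kubo road `noisyPositiveConductance_of_dualForwardFields`, DISCHARGED.** For all parameters `> 0`,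
`T > 0`, `ε > 0`, the unique flip-steady family `μ` and `L ≥ 2`: the family `g δ` := (the centred mild forward
field at `(T + δ/2, T − δ/2)`, `0 < |δ| < T`; the smooth representative `g̃` of the mild forward field at
`(T, T)`, `δ = 0`) satisfies clauses (i)–(iv) of `noisyPositiveConductance_of_dualForwardFields` with `δ₀ = T`.
(i): MILD gives the weak equation of the mild field `g₀'` at `(T,T)` (its centring constant is
`∫ (p_0² − T) dμ_T = 0` by uniqueness and equipartition), HYPO a smooth `g̃ = g₀'` a.e., UPGRADE its bound and
mild equation, MILD again its weak equation, `flip_classical_of_weak_smooth` the classical one. (ii)–(iii):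
existence (`flip_mildForwardField_exists_temps`) + MILD. (iv): CONT with `c δ = ∫ (p_0² − T) dμ_δ → 0`
(`flip_tendsto_centring`). -/
theorem flip_dualForwardFields :
    ∀ (ω₂ lam β γ T ε : ℝ), 0 < ω₂ → 0 < lam → 0 < β → 0 < γ → 0 < T → 0 < ε →
      ∀ μ : (N : ℕ) → ℝ → ℝ → Measure (PhaseSpace N),
        (∀ (N : ℕ) (T_L T_R : ℝ), 0 < T_L → 0 < T_R →
          (pinnedChain ω₂ lam β γ).IsFlipSteadyState N T_L T_R ε (μ N T_L T_R) ∧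
            ∀ ν : Measure (PhaseSpace N),
              (pinnedChain ω₂ lam β γ).IsFlipSteadyState N T_L T_R ε ν → ν = μ N T_L T_R) →
        ∀ (L : ℕ) (hL : 2 ≤ L),
          ∃ (g : ℝ → PhaseSpace L → ℝ) (δ₀ : ℝ), 0 < δ₀ ∧
            ContDiff ℝ 2 (g 0) ∧
            (∀ x, (pinnedChain ω₂ lam β γ).flipGenerator L T T ε (g 0) x =
              -(Theorems.SuperadditiveResistance.DeviceLiouville.kin L 0 x - T)) ∧
            (∀ δ, |δ| < δ₀ → ∃ C : ℝ, ∀ x,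
              |g δ x| ≤ C * Real.exp (1 / (4 * T) * (pinnedChain ω₂ lam β γ).hamiltonian L x)) ∧
            (∀ δ, 0 < |δ| → |δ| < δ₀ → Measurable (g δ) ∧
              ∀ φ : PhaseSpace L → ℝ, ContDiff ℝ ((⊤ : ℕ∞) : WithTop ℕ∞) φ → HasCompactSupport φ →
                ∫ x, g δ x * (-((pinnedChain ω₂ lam β γ).generator L (T + δ / 2) (T - δ / 2) φ x) +
                    2 * γ * ((T + δ / 2) * partialP (⟨0, by omega⟩ : Fin L) (partialP (⟨0, by omega⟩ : Fin L) φ) x +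
                      (T - δ / 2) * partialP (⟨L - 1, by omega⟩ : Fin L)
                        (partialP (⟨L - 1, by omega⟩ : Fin L) φ) x) +
                    2 * γ * φ x + ε * flipNoise L φ x) =
                  ∫ x, (-(Theorems.SuperadditiveResistance.DeviceLiouville.kin L 0 x - T) +
                    ∫ y, (Theorems.SuperadditiveResistance.DeviceLiouville.kin L 0 y - T)
                      ∂(μ L (T + δ / 2) (T - δ / 2))) * φ x) ∧
            Tendsto (fun δ => ∫ x, g δ x * (Theorems.SuperadditiveResistance.DeviceLiouville.kin L 0 x - T)
                ∂((pinnedChain ω₂ lam β γ).gibbsMeasure L T)) (𝓝[≠] 0)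
              (𝓝 (∫ x, g 0 x * (Theorems.SuperadditiveResistance.DeviceLiouville.kin L 0 x - T)
                ∂((pinnedChain ω₂ lam β γ).gibbsMeasure L T))) ∧
            Tendsto (fun δ => ∫ x, g δ x * (Theorems.SuperadditiveResistance.DeviceLiouville.kin L (L - 1) x - T)
                ∂((pinnedChain ω₂ lam β γ).gibbsMeasure L T)) (𝓝[≠] 0)
              (𝓝 (∫ x, g 0 x * (Theorems.SuperadditiveResistance.DeviceLiouville.kin L (L - 1) x - T)
                ∂((pinnedChain ω₂ lam β γ).gibbsMeasure L T))) := by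
  intro ω₂ lam β γ T ε hω hl hβ hγ hT hε μ hμ L hL
  have hL1 : 1 < L := hL
  have hL0 : 0 < L := by omega
  set P := pinnedChain ω₂ lam β γ with hP
  -- bath temperatures `T ± δ/2` for `|δ| < T`
  have htemp : ∀ δ : ℝ, |δ| < T → 0 < T + δ / 2 ∧ 0 < T - δ / 2 ∧
      1 / (4 * T) < 1 / max (T + δ / 2) (T - δ / 2) := by
    intro δ hδ
    have h1 := abs_lt.mp hδ
    refine ⟨by linarith, by linarith, ?_⟩
    rw [div_lt_div_iff₀ (by positivity) (lt_max_of_lt_left (by linarith))]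
    have : max (T + δ / 2) (T - δ / 2) < 4 * T := max_lt (by linarith) (by linarith)
    linarith
  -- δ = 0: the mild field at (T, T); its centring constant vanishes
  have hμT := hμ L T T hT hT
  have h4T : 1 / (4 * T) < 1 / max T T := by
    rw [max_self, div_lt_div_iff₀ (by positivity) hT]; nlinarith
  obtain ⟨g₀', hg₀'m, hg₀'b, hg₀'eq⟩ :=
    flip_mildForwardField_exists_temps hω hl hβ hγ hL1 hT hT hT h4T hε hμT
  set c₀ : ℝ := ∫ w, (w.2 ⟨0, Nat.zero_lt_of_lt hL1⟩ ^ 2 - T) ∂(μ L T T) with hc₀def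
  have hgibbs : μ L T T = P.gibbsMeasure L T :=
    (hμT.2 _ (pinnedChain_isFlipSteadyState_gibbsMeasure hω hl.le hβ.le γ L hT ε)).symm
  haveI : IsProbabilityMeasure (P.gibbsMeasure L T) :=
    pinnedChain_isProbabilityMeasure_gibbsMeasure hω hl.le hβ.le γ L hT
  have hc₀ : c₀ = 0 := by
    rw [hc₀def, hgibbs, integral_sub ((pinnedChain_memLp_two_snd hω hl.le hβ.le γ L hT _).integrable_sq)
      (integrable_const _), pinnedChain_integral_snd_sq hω hl.le hβ.le γ L hT, integral_const]
    simp
  -- MILD for `g₀'`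
  have hweak₀' := stub_flipMildDistributional ω₂ lam β γ hω hl hβ hγ L hL T T T hT hT hT h4T ε hε c₀ g₀' hg₀'m
    hg₀'b hg₀'eq
  -- HYPO: a smooth representative
  have hF : ContDiff ℝ ((⊤ : ℕ∞) : WithTop ℕ∞)
      (fun x : PhaseSpace L => -(Theorems.SuperadditiveResistance.DeviceLiouville.kin L 0 x - T) + c₀) := by
    have hk : ContDiff ℝ ((⊤ : ℕ∞) : WithTop ℕ∞)
        (fun x : PhaseSpace L => Theorems.SuperadditiveResistance.DeviceLiouville.kin L 0 x) := by
      have : (fun x : PhaseSpace L => Theorems.SuperadditiveResistance.DeviceLiouville.kin L 0 x) =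
          fun x => x.2 ⟨0, hL0⟩ ^ 2 := funext fun x => Theorems.SuperadditiveResistance.DeviceLiouville.kin_eq_sq hL0 x
      rw [this]; fun_prop
    exact (hk.sub contDiff_const).neg.add contDiff_const
  obtain ⟨C₀', hC₀'⟩ := hg₀'b
  obtain ⟨gs, hgs, hae⟩ := stub_flipHypoelliptic ω₂ lam β γ hω hl hβ hγ L hL T T ε hT hT hε.le g₀' _ hg₀'m
    ⟨C₀', 1 / (4 * T), hC₀'⟩ hF hweak₀'
  -- UPGRADE: the smooth representative is bounded and mild
  obtain ⟨hgsb, hgseq⟩ := stub_flipSmoothMildUpgrade ω₂ lam β γ hω hl hβ hγ L hL T hT ε hε c₀ g₀' gs hg₀'m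
    ⟨C₀', hC₀'⟩ hg₀'eq hgs.continuous hae
  -- MILD for the smooth representative, then the classical equation
  have hweaks := stub_flipMildDistributional ω₂ lam β γ hω hl hβ hγ L hL T T T hT hT hT h4T ε hε c₀ gs
    hgs.continuous.measurable hgsb hgseq
  have hclass : ∀ x, P.generator L T T gs x + ε * flipNoise L gs x =
      -(Theorems.SuperadditiveResistance.DeviceLiouville.kin L 0 x - T) + c₀ :=
    flip_classical_of_weak_smooth P (pinnedChain_contDiff_U ω₂ lam β γ)
      (pinnedChain_contDiff_V ω₂ lam β γ) hL0 (T_L := T) (T_R := T)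
      (by show 0 ≤ γ * T; positivity) (by show 0 ≤ γ * T; positivity) ε hgs hF.continuous hweaks
  -- the δ ≠ 0 members of the family, by choice
  have hex : ∀ (δ : ℝ) (hδ0 : 0 < |δ|) (hδ : |δ| < T), ∃ gδ : PhaseSpace L → ℝ, Measurable gδ ∧
      (∃ C : ℝ, ∀ z, |gδ z| ≤ C * Real.exp (1 / (4 * T) * P.hamiltonian L z)) ∧
      ∀ z, gδ z = ∫ y, (((L : ℝ) * ε)⁻¹ * ((y.2 ⟨0, Nat.zero_lt_of_lt hL1⟩ ^ 2 - T) -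
            ∫ w, (w.2 ⟨0, Nat.zero_lt_of_lt hL1⟩ ^ 2 - T) ∂(μ L (T + δ / 2) (T - δ / 2))) +
          (L : ℝ)⁻¹ * ∑ i : Fin L, gδ (momentumFlip i y))
        ∂((pinnedChainSemigroup hω hl.le hβ.le hγ.le (Nat.zero_lt_of_lt hL1) (htemp δ hδ).1.le
          (htemp δ hδ).2.1.le).resolventKernel ((L : ℝ) * ε) z) := by
    intro δ hδ0 hδ
    exact flip_mildForwardField_exists_temps hω hl hβ hγ hL1 hT (htemp δ hδ).1
      (htemp δ hδ).2.1 (htemp δ hδ).2.2 hε (hμ L _ _ (htemp δ hδ).1 (htemp δ hδ).2.1)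
  classical
  let g : ℝ → PhaseSpace L → ℝ := fun δ => if h : 0 < |δ| ∧ |δ| < T then (hex δ h.1 h.2).choose else gs
  have hg0 : g 0 = gs := by simp [g]
  have hgδ : ∀ δ (h : 0 < |δ| ∧ |δ| < T), g δ = (hex δ h.1 h.2).choose := fun δ h => dif_pos h
  -- centring constants
  let c : ℝ → ℝ := fun δ => ∫ w, (w.2 ⟨0, Nat.zero_lt_of_lt hL1⟩ ^ 2 - T) ∂(μ L (T + δ / 2) (T - δ / 2))
  have hc : Tendsto c (𝓝[≠] 0) (𝓝 c₀) := by
    have := flip_tendsto_centring hω hl hβ hγ hT hε μ hμ hL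
    simpa [c, hc₀def] using this
  refine ⟨g, T, hT, ?_, ?_, ?_, ?_, ?_⟩
  · -- (i) regularity
    rw [hg0]; exact hgs.of_le (by norm_cast)
  · -- (i) classical equation
    intro x
    rw [hg0, OscillatorChain.flipGenerator_eq_add_flipNoise, hclass x, hc₀, add_zero]
  · -- (ii) bounds
    intro δ hδ
    by_cases h0 : 0 < |δ|
    · rw [hgδ δ ⟨h0, hδ⟩]; exact (hex δ h0 hδ).choose_spec.2.1
    · have : δ = 0 := by simpa using le_antisymm (not_lt.mp h0) (abs_nonneg δ)
      subst this; rw [hg0]; exact hgsb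
  · -- (iii) measurability and the weak equation (MILD)
    intro δ hδ0 hδ
    rw [hgδ δ ⟨hδ0, hδ⟩]
    obtain ⟨hm, hb, heq⟩ := (hex δ hδ0 hδ).choose_spec
    refine ⟨hm, fun φ hφ hφc => ?_⟩
    have hw := stub_flipMildDistributional ω₂ lam β γ hω hl hβ hγ L hL T (T + δ / 2) (T - δ / 2) hT
      (htemp δ hδ).1 (htemp δ hδ).2.1 (htemp δ hδ).2.2 ε hε (c δ) _ hm hb heq φ hφ hφc
    rw [hw]
    congr 1
    funext x
    congr 2
    exact integral_congr_ae (ae_of_all _ fun y =>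
      (congrArg (· - T) (Theorems.SuperadditiveResistance.DeviceLiouville.kin_eq_sq hL0 y)).symm)
  · -- (iv) CONT
    have hcont := stub_flipMildContinuity ω₂ lam β γ hω hl hβ hγ L hL T hT ε hε g c gs c₀ T hT le_rfl hc
      hgs.continuous hgsb hgseq (fun δ hTL hTR hδ0 hδ => by
        rw [hgδ δ ⟨hδ0, hδ⟩]
        exact (hex δ hδ0 hδ).choose_spec)
    rw [hg0]
    exact hcont

/-- **S3 · noisyPositiveConductance — every finite noisy chain conducts (sorry-free).** For all parameters `> 0`, `T > 0` and EVERY flip rate `ε > 0`: along the unique flip-steady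
family the responses satisfy `D_N(ε) > 0` for all `N ≥ 2`. Flip twin of stmt-AtomisticToContinuum-11750
(`JunctionLocality.PositiveConductance`). Proof: the landed DUAL Kubo road
`noisyPositiveConductance_of_dualForwardFields` (p105569: energy balance, the exact
dual identity `μ_δ(p_0² − T)/δ = (γ/2T²)(⟨g_δ,k_0⟩ − ⟨g_δ,k_{L−1}⟩)`, the row sum and the Onsager sign
`0 < γ(1 − (γ/T²)⟨g_0,k_0⟩) ≤ γ`) fed with `flip_dualForwardFields`. -/
theorem flip_noisyPositiveConductance :
    ∀ ω₂ lam β γ : ℝ, 0 < ω₂ → 0 < lam → 0 < β → 0 < γ → ∀ T : ℝ, 0 < T → ∀ ε : ℝ, 0 < ε →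
      ∀ μ : (N : ℕ) → ℝ → ℝ → Measure (PhaseSpace N),
        (∀ (N : ℕ) (T_L T_R : ℝ), 0 < T_L → 0 < T_R →
          (pinnedChain ω₂ lam β γ).IsFlipSteadyState N T_L T_R ε (μ N T_L T_R) ∧
            ∀ ν : Measure (PhaseSpace N),
              (pinnedChain ω₂ lam β γ).IsFlipSteadyState N T_L T_R ε ν → ν = μ N T_L T_R) →
        ∀ D : ℕ → ℝ,
          (∀ N : ℕ, Tendsto (fun δ : ℝ =>
            (pinnedChain ω₂ lam β γ).totalCurrent (μ N (T + δ / 2) (T - δ / 2)) / δ)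
            (𝓝[≠] 0) (𝓝 (D N))) →
          ∀ N : ℕ, 2 ≤ N → 0 < D N :=
  noisyPositiveConductance_of_dualForwardFields flip_dualForwardFields


/-! ## Registered helper -/

/-- Registered helper sub-goal `helper_noisyPositiveConductance` of crux stmt-AtomisticToContinuum-11976 (line `fekete-usc-one-length`,
stub S3 of the planner's skeleton): every finite flip-noisy chain conducts (`flip_noisyPositiveConductance`). -/
theorem helper_noisyPositiveConductance : ∀ ω₂ lam β γ : ℝ, 0 < ω₂ → 0 < lam → 0 < β → 0 < γ → ∀ T : ℝ, 0 < T → ∀ ε : ℝ, 0 < ε → ∀ μ : (N : ℕ) → ℝ → ℝ → Measure (PhaseSpace N), (∀ (N : ℕ) (T_L T_R : ℝ), 0 < T_L → 0 < T_R → (pinnedChain ω₂ lam β γ).IsFlipSteadyState N T_L T_R ε (μ N T_L T_R) ∧ ∀ ν : Measure (PhaseSpace N), (pinnedChain ω₂ lam β γ).IsFlipSteadyState N T_L T_R ε ν → ν = μ N T_L T_R) → ∀ D : ℕ → ℝ, (∀ N : ℕ, Tendsto (fun δ : ℝ => (pinnedChain ω₂ lam β γ).totalCurrent (μ N (T + δ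 / 2) (T - δ / 2)) / δ) (𝓝[≠] 0) (𝓝 (D N))) → ∀ N : ℕ, 2 ≤ N → 0 < D N :=
  flip_noisyPositiveConductance

end Summit.AtomisticToContinuum.FouriersLaw.Theorems.VanishingNoiseBound

end
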